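import Literature.MathematicalPhysics.QuantumManyBody.PeriodicBoseGasSector
import Literature.MathematicalPhysics.QuantumManyBody.PeriodicBoseGasEq317
import HarnessLib

/-!
# Fournais 2020, Theorem 2.1 from the `n`-particle bound (2.43)

Topic `Literature/MathematicalPhysics/QuantumManyBody` (provefact
`Literature.MathematicalPhysics.QuantumManyBody.BoseGas.Fournais2020_condensation`). We prove
`Fournais2020_thm21_of_eq243 : Fournais2020_eq243 → Fournais2020_thm21`: the small-box theorem
[Fournais2020, Thm. 2.1] (`PeriodicBoseGasBox.lean`) follows from the bound
`(H_Λ(ρ_μ))_n ≥ E_Main + E_gap + E_error` on each `n`-particle sector [Fournais2020,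
(2.43)–(2.46)] (`Fournais2020_eq243`, `PeriodicBoseGasSector.lean`) by the particle-number
bookkeeping of the printed proof (pp. 7 and 12–13):

1. *Grouping* (2.12)–(2.14). The `M` particles are divided into groups `S_j` of
   `m = ⌈Ξρ_μℓ³⌉ ∈ [Ξρ_μℓ³, (Ξ+1)ρ_μℓ³]` particles (`ρ_μℓ³ ≥ 1`) and a last group of fewer;
   dropping the (non-negative) interaction between different groups,
   `⟨Ψ,(H_Λ)_MΨ⟩ ≥ ∑_j ⟨Ψ, (H_Λ)_{|S_j|}^{(S_j)} Ψ⟩`, and each term is bounded fibrewise: for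
   fixed positions `Y` of the particles outside `S_j`, `Ψ(·,Y)` is a symmetric `|S_j|`-body
   function on `Λ^{|S_j|}` (the sectioning `Λ^M ≃ Λ^{|S|} × Λ^{Sᶜ}` of
   `PeriodicBoseGasEq317.lean`).
2. *The sectors* (2.47)–(2.50), with `Ξ = 3`. For `n ≤ (Ξ+1)ρ_μℓ³` and `K² ≥ 12C/b`,
   `E_gap ≥ 0` (2.48) (here: the `n₊`-terms of (2.43) cancel against the saved gap
   `bℓ⁻²n₊ ≤ ∑T^{(i)}`), and `E_error ≥ -Cρ_μa(1 + (R/a)²√(ρ_μa³))` (2.47), which is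
   `-C₀ρ_μ²aℓ³√(ρ_μa³)` as `ρ_μa = K³ρ_μ²aℓ³√(ρ_μa³)`; so (2.49)
   `(H_Λ)_n ≥ -4πaρ_μ²ℓ³(1 + C₀√(ρ_μa³)) + 2π(a/ℓ³)(ρ_μℓ³ - n)²`. For the full groups,
   `n ≥ Ξρ_μℓ³` and `Ξ ≥ 3` give `2π(a/ℓ³)(ρ_μℓ³-n)² ≥ 8πaρ_μ²ℓ³`, whence (2.50)
   `(H_Λ)_n ≥ 0` for `ρ_μa³` small; the last group contributes (2.49) without the square.
   Summing over the groups gives (2.11).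

The splitting equivalence and the enumeration of `S` are the local notations `split[S]`, `eS[S]`
of `PeriodicBoseGasEq317.lean`, re-declared here so that its lemmas apply verbatim.

## References

* [Fournais2020] S. Fournais, *Length scales for BEC in the dilute Bose gas*, arXiv:2011.00309,
  EMS Ser. Congr. Rep. 18 (2021): Thm. 2.1, (2.11)–(2.14), (2.43)–(2.50).
-/

noncomputable section

open MeasureTheory Filter Set WithLp
open scoped ENNReal NNReal Topology

namespace Literature.MathematicalPhysics.QuantumManyBody.BoseGas

/-- The increasing enumeration `Fin |S| ≃o S` (local notation, as in
`PeriodicBoseGasEq317.lean`). -/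
local notation "eS[" S "]" => Finset.orderIsoOfFin S rfl

/-- The measurable equivalence `(ℝ³)^N ≃ (ℝ³)^{|S|} × (ℝ³)^{Sᶜ}`, `X ↦ ((X_{e_S(j)})_j, X|_{Sᶜ})`
(local notation, as in `PeriodicBoseGasEq317.lean`). -/
local notation "split[" S "]" =>
  MeasurableEquiv.trans
    (MeasurableEquiv.piEquivPiSubtypeProd (fun _ : Fin _ => Space) (fun i => i ∈ S))
    (MeasurableEquiv.prodCongr
      (MeasurableEquiv.symm
        (MeasurableEquiv.piCongrLeft (fun _ : {i // i ∈ S} => Space)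
          (RelIso.toEquiv (Finset.orderIsoOfFin S rfl))))
      (MeasurableEquiv.refl ({i // i ∉ S} → Space)))

variable {M : ℕ} {ℓ : ℝ} {u : Space}

/-! ### Sectioning `Λ^M ≃ Λ^{|S|} × Λ^{Sᶜ}` -/

section Sectioning

/-- `Λ(u)^M` is the cell `Λ^S × Λ^{Sᶜ}` of the trivial partition. [folklore] -/
theorem boxConfig_eq_piSel (S : Finset (Fin M)) (ℓ : ℝ) (u : Space) :
    boxConfig M ℓ u = Set.pi Set.univ (fun i => ite (i ∈ S) (slidingBox ℓ u) (slidingBox ℓ u)) := by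
  ext X
  simp only [boxConfig, Set.mem_setOf_eq, ite_self, Set.mem_univ_pi]

/-- **Sectioning of `Λ^M`** by a set `S` of particles:
`∫_{Λ^M} F = ∫_{Λ^{Sᶜ}} ∫_{Λ^{|S|}} F(Z ⊔ Y) dZ dY`. [cite: Fournais2020, (2.14)] -/
theorem lintegral_boxConfig_eq (S : Finset (Fin M)) (ℓ : ℝ) (u : Space) {F : Config M → ℝ≥0∞}
    (hF : Measurable F) :
    ∫⁻ X in boxConfig M ℓ u, F X =
      ∫⁻ Y in Set.univ.pi fun _ : {i // i ∉ S} => slidingBox ℓ u,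
        ∫⁻ Z in boxConfig S.card ℓ u, F ((split[S]).symm (Z, Y)) := by
  rw [boxConfig_eq_piSel S, lintegral_piSel_eq S _ _ hF, boxConfig_eq_pi]

/-- A sum over the particles of `S` at `Z ⊔ Y` is a sum over the enumeration of `S`.
[folklore] -/
theorem sum_mem_split_symm (S : Finset (Fin M)) (Z : Config S.card) (Y : {i // i ∉ S} → Space)
    (φ : Space → ℝ≥0∞) :
    ∑ i ∈ S, φ ((split[S]).symm (Z, Y) i) = ∑ j : Fin S.card, φ (Z j) := by
  rw [← Finset.sum_coe_sort]
  refine Fintype.sum_equiv (RelIso.toEquiv (eS[S])).symm (fun i => φ ((split[S]).symm (Z, Y) i))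
    (fun j => φ (Z j)) fun i => ?_
  have h := split_symm_apply_coe S Z Y ((RelIso.toEquiv (eS[S])).symm i)
  rw [show ((eS[S]) ((RelIso.toEquiv (eS[S])).symm i) : Fin M) = i from by
    rw [show (RelIso.toEquiv (eS[S])).symm i = (eS[S]).symm i from rfl, OrderIso.apply_symm_apply]] at h
  rw [h]

/-- A sum over the ordered pairs of particles of `S` at `Z ⊔ Y` is the sum over the pairs of the
enumeration (which is increasing). [folklore] -/
theorem sum_sum_mem_split_symm (S : Finset (Fin M)) (Z : Config S.card) (Y : {i // i ∉ S} → Space)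
    (ψ : Space → Space → ℝ≥0∞) :
    ∑ i ∈ S, ∑ i' ∈ S with i < i', ψ ((split[S]).symm (Z, Y) i) ((split[S]).symm (Z, Y) i') =
      ∑ j : Fin S.card, ∑ j' : Fin S.card with j < j', ψ (Z j) (Z j') := by
  classical
  -- pass to sums over all particles of quantities vanishing off `S`
  have h1 : ∑ i ∈ S, ∑ i' ∈ S with i < i', ψ ((split[S]).symm (Z, Y) i) ((split[S]).symm (Z, Y) i') =
      ∑ i, ∑ i', if i ∈ S ∧ i' ∈ S ∧ i < i' then
        ψ ((split[S]).symm (Z, Y) i) ((split[S]).symm (Z, Y) i') else 0 := by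
    rw [← Finset.sum_subset (Finset.subset_univ S) fun i _ hi => by simp [hi]]
    refine Finset.sum_congr rfl fun i hi => ?_
    rw [Finset.sum_filter, ← Finset.sum_subset (Finset.subset_univ S) fun i' _ hi' => by simp [hi']]
    refine Finset.sum_congr rfl fun i' hi' => ?_
    simp [hi, hi']
  rw [h1, sum_eq_sum_enum S fun i hi => Finset.sum_eq_zero fun i' _ => by simp [hi]]
  refine Finset.sum_congr rfl fun j _ => ?_
  rw [Finset.sum_filter, sum_eq_sum_enum S fun i' hi' => by simp [hi']]
  refine Finset.sum_congr rfl fun j' _ => ?_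
  rw [split_symm_apply_coe, split_symm_apply_coe]
  by_cases h : j < j'
  · rw [if_pos h, if_pos ⟨(eS[S] j).2, (eS[S] j').2, Subtype.coe_lt_coe.2 ((eS[S]).lt_iff_lt.2 h)⟩]
  · rw [if_neg h, if_neg fun h' => h ((eS[S]).lt_iff_lt.1 (Subtype.coe_lt_coe.1 h'.2.2))]

end Sectioning

/-! ### The Hamiltonian of a group of particles and its fibres -/

section Groups

variable {χ : Space → ℝ} {v : ℝ → ℝ≥0∞} {ω : Space → ℝ}

/-- **Attraction of a group, fibrewise**: `ρ_μ∑_{i∈S}∫w₁(xᵢ,y)dy` at `Z ⊔ Y` is the attraction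
`ρ_μ∑_{j≤|S|}∫w₁(zⱼ,y)dy` of the `|S|`-body configuration `Z`. [cite: Fournais2020, (2.14)] -/
theorem attr_group_split_symm (S : Finset (Fin M)) (ρμ : ℝ) (Z : Config S.card)
    (Y : {i // i ∉ S} → Space) :
    ENNReal.ofReal ρμ * ∑ i ∈ S, ∫⁻ y, pairLoc₁ v ω χ ℓ u ((split[S]).symm (Z, Y) i) y =
      attrBoxN v ω χ ℓ ρμ u Z := by
  unfold attrBoxN
  rw [sum_mem_split_symm S Z Y fun x => ∫⁻ y, pairLoc₁ v ω χ ℓ u x y]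

/-- **Repulsion within a group, fibrewise**: `∑_{i<i' ∈ S} w(xᵢ,x_{i'})` at `Z ⊔ Y` is the
repulsion of the `|S|`-body configuration `Z`. [cite: Fournais2020, (2.14)] -/
theorem rep_group_split_symm (S : Finset (Fin M)) (Z : Config S.card) (Y : {i // i ∉ S} → Space) :
    ∑ i ∈ S, ∑ i' ∈ S with i < i',
        pairLoc v χ ℓ u ((split[S]).symm (Z, Y) i) ((split[S]).symm (Z, Y) i') =
      repBoxN v χ ℓ u Z := by
  unfold repBoxN
  exact sum_sum_mem_split_symm S Z Y (pairLoc v χ ℓ u)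

end Groups

/-! ### Measurability of the slice forms for measurable `Φ` -/

section Measurability

open scoped FourierTransform

variable {N : ℕ}

/-- Joint (strong) measurability of `(X, x) ↦ (Q_u Φ(X; ·ᵢ))(x)` for measurable `Φ`
(cf. `stronglyMeasurable_projQ_slice`, stated for continuous `Φ` and varying `u`). [folklore] -/
theorem stronglyMeasurable_projQ_slice' (ℓ : ℝ) (u : Space) (i : Fin N) {Φ : Config N → ℂ}
    (hΦ : Measurable Φ) :
    StronglyMeasurable fun r : Config N × Space =>
      projQ ℓ u (fun x => Φ (Function.update r.1 i x)) r.2 := by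
  set S : Set (Config N × Space) := {r | r.2 ∈ slidingBox ℓ u} with hSdef
  have hsl : Measurable fun r : Config N × Space => Φ (Function.update r.1 i r.2) :=
    hΦ.comp measurable_update'
  have hS : MeasurableSet S := measurable_snd (measurableSet_slidingBox ℓ u)
  have hM : StronglyMeasurable fun X : Config N => ∫ y in slidingBox ℓ u, Φ (Function.update X i y) := by
    have h := (hsl.stronglyMeasurable.indicator hS).integral_prod_right' (ν := (volume : Measure Space))
    have hfun : (fun X : Config N => ∫ y in slidingBox ℓ u, Φ (Function.update X i y)) =
        fun X => ∫ y, S.indicator (fun r => Φ (Function.update r.1 i r.2)) (X, y) := by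
      funext X
      rw [← integral_indicator (measurableSet_slidingBox ℓ u)]
      rfl
    rw [hfun]
    exact h
  have hfun : (fun r : Config N × Space => projQ ℓ u (fun x => Φ (Function.update r.1 i x)) r.2) =
      S.indicator fun r => Φ (Function.update r.1 i r.2) -
        ((ℓ ^ 3)⁻¹ : ℝ) • ∫ y in slidingBox ℓ u, Φ (Function.update r.1 i y) := by
    funext r
    rfl
  rw [hfun]
  exact (hsl.stronglyMeasurable.sub ((hM.comp_measurable measurable_fst).const_smul ((ℓ ^ 3)⁻¹ : ℝ))).indicator hS

/-- Joint measurability of `(X, p) ↦ 𝓕(χ_u Q_u Φ(X; ·ᵢ))(p)` for measurable `Φ`. [folklore] -/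
theorem stronglyMeasurable_fourier_slice' {χ : Space → ℝ} (hχ : Continuous χ) (ℓ : ℝ) (u : Space)
    (i : Fin N) {Φ : Config N → ℂ} (hΦ : Measurable Φ) :
    StronglyMeasurable fun r : Config N × Space =>
      𝓕 (fun x => (locFun χ ℓ u x : ℂ) * projQ ℓ u (fun x => Φ (Function.update r.1 i x)) x) r.2 := by
  have hfun : (fun r : Config N × Space =>
      𝓕 (fun x => (locFun χ ℓ u x : ℂ) * projQ ℓ u (fun x => Φ (Function.update r.1 i x)) x) r.2) =
      fun r => ∫ y : Space, Complex.exp (↑(-2 * Real.pi * inner ℝ y r.2) * Complex.I) •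
        ((locFun χ ℓ u y : ℂ) * projQ ℓ u (fun x => Φ (Function.update r.1 i x)) y) :=
    funext fun r => Real.fourier_eq' _ _
  rw [hfun]
  have hK : Continuous fun r : (Config N × Space) × Space =>
      Complex.exp (↑(-2 * Real.pi * inner ℝ r.2 r.1.2) * Complex.I) := by
    fun_prop
  have hp : Measurable fun r : (Config N × Space) × Space => (r.1.1, r.2) := by
    fun_prop
  have hloc : Continuous fun y : Space => (locFun χ ℓ u y : ℂ) := by
    refine Complex.continuous_ofReal.comp ?_
    unfold locFun
    fun_prop
  have hF0 : StronglyMeasurable fun q : Config N × Space =>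
      (locFun χ ℓ u q.2 : ℂ) * projQ ℓ u (fun x => Φ (Function.update q.1 i x)) q.2 :=
    ((hloc.comp continuous_snd).stronglyMeasurable).mul (stronglyMeasurable_projQ_slice' ℓ u i hΦ)
  have hF := hF0.comp_measurable hp
  have hprod := hK.stronglyMeasurable.smul hF
  exact hprod.integral_prod_right' (ν := (volume : Measure Space))

/-- **Measurability of `X ↦ ⟨Φ(X; ·ᵢ), T_u Φ(X; ·ᵢ)⟩`** for measurable `Φ`. [folklore] -/
theorem measurable_kinLoc_slice' {χ : Space → ℝ} (hχ : Continuous χ) (ℓ s b : ℝ) (u : Space)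
    (i : Fin N) {Φ : Config N → ℂ} (hΦ : Measurable Φ) :
    Measurable fun X : Config N => kinLoc χ ℓ s b u fun x => Φ (Function.update X i x) := by
  unfold kinLoc
  refine Measurable.add ?_ (Measurable.const_mul ?_ _)
  · refine Measurable.lintegral_prod_right' (f := fun r : Config N × Space =>
      ENNReal.ofReal (4 * Real.pi ^ 2 * ‖r.2‖ ^ 2 - (s * ℓ)⁻¹ ^ 2) *
        (‖𝓕 (fun x => (locFun χ ℓ u x : ℂ) *
          projQ ℓ u (fun x => Φ (Function.update r.1 i x)) x) r.2‖₊ : ℝ≥0∞) ^ 2) ?_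
    refine Measurable.mul (ENNReal.measurable_ofReal.comp (by fun_prop)) ?_
    exact ((stronglyMeasurable_fourier_slice' hχ ℓ u i hΦ).measurable.nnnorm.coe_nnreal_ennreal).pow_const _
  · refine Measurable.lintegral_prod_right' (f := fun r : Config N × Space =>
      (‖projQ ℓ u (fun x => Φ (Function.update r.1 i x)) r.2‖₊ : ℝ≥0∞) ^ 2) ?_
    exact ((stronglyMeasurable_projQ_slice' ℓ u i hΦ).measurable.nnnorm.coe_nnreal_ennreal).pow_const _

/-- Measurability of `X ↦ ‖Q_u Φ(X; ·ᵢ)‖²` (the integrand of `nPlusBoxN`) for measurable `Φ`.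
[folklore] -/
theorem measurable_projQPart_slice' (ℓ : ℝ) (u : Space) (i : Fin N) {Φ : Config N → ℂ}
    (hΦ : Measurable Φ) :
    Measurable fun X : Config N =>
      ∫⁻ x, (‖projQ ℓ u (fun y => Φ (Function.update X i y)) x‖₊ : ℝ≥0∞) ^ 2 := by
  refine Measurable.lintegral_prod_right' (f := fun r : Config N × Space =>
    (‖projQ ℓ u (fun x => Φ (Function.update r.1 i x)) r.2‖₊ : ℝ≥0∞) ^ 2) ?_
  exact ((stronglyMeasurable_projQ_slice' ℓ u i hΦ).measurable.nnnorm.coe_nnreal_ennreal).pow_const _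

variable {χ : Space → ℝ} {v : ℝ → ℝ≥0∞} {ω : Space → ℝ}

/-- `X ↦ ρ_μ∑_{i∈S}∫w₁(xᵢ,y)dy` is measurable. [cite: Fournais2020, (2.6)] -/
theorem measurable_attr_group (hvm : Measurable v) (hω : Measurable ω) (hχ : IsLocalizationFunction χ)
    (ℓ ρμ : ℝ) (u : Space) (S : Finset (Fin N)) :
    Measurable fun X : Config N =>
      ENNReal.ofReal ρμ * ∑ i ∈ S, ∫⁻ y, pairLoc₁ v ω χ ℓ u (X i) y := by
  have hterm : ∀ i : Fin N, Measurable fun X : Config N => ∫⁻ y, pairLoc₁ v ω χ ℓ u (X i) y := by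
    intro i
    have hi : Measurable fun q : Config N × Space => q.1 i := (measurable_pi_apply i).comp measurable_fst
    have h := (measurable_pairLoc₁₂ hvm hω hχ ℓ u).comp (hi.prodMk measurable_snd)
    have h' : Measurable fun q : Config N × Space => pairLoc₁ v ω χ ℓ u (q.1 i) q.2 := h
    exact h'.lintegral_prod_right'
  exact (Finset.measurable_sum _ fun i _ => hterm i).const_mul _

/-- `X ↦ ∑_{i<i' ∈ S} w(xᵢ,x_{i'})` is measurable. [cite: Fournais2020, (2.6)] -/
theorem measurable_rep_group (hvm : Measurable v) (hχ : IsLocalizationFunction χ) (ℓ : ℝ) (u : Space)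
    (S : Finset (Fin N)) :
    Measurable fun X : Config N => ∑ i ∈ S, ∑ i' ∈ S with i < i', pairLoc v χ ℓ u (X i) (X i') := by
  have hij : ∀ i j : Fin N, Measurable fun X : Config N => pairLoc v χ ℓ u (X i) (X j) := by
    intro i j
    have hi : Measurable fun X : Config N => X i := measurable_pi_apply i
    have hj : Measurable fun X : Config N => X j := measurable_pi_apply j
    have h := (measurable_pairLoc₂ hvm hχ ℓ u).comp (hi.prodMk hj)
    exact h
  exact Finset.measurable_sum _ fun i _ => Finset.measurable_sum _ fun j _ => hij i j

end Measurability

/-! ### The bound on a group of particles from the bounds on its fibres -/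

section GroupBound

variable {χ : Space → ℝ} {v : ℝ → ℝ≥0∞} {ω : Space → ℝ}

/-- A sum over `S` is a sum over its enumeration. [folklore] -/
theorem sum_mem_eq_sum_enum (S : Finset (Fin M)) (G : Fin M → ℝ≥0∞) :
    ∑ i ∈ S, G i = ∑ j : Fin S.card, G (eS[S] j) := by
  rw [← Finset.sum_coe_sort]
  exact Fintype.sum_equiv (RelIso.toEquiv (eS[S])).symm (fun i => G i) (fun j => G (eS[S] j))
    fun i => by
      change G i = G ((eS[S]) ((eS[S]).symm i))
      rw [OrderIso.apply_symm_apply]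

/-- **The Hamiltonian of a group of particles is bounded through its fibres** ((2.14): "discard
the interaction between particles in different groups … reduce the analysis to
`(H_Λ(ρ_μ))_n`"). If for (almost) every position `Y ∈ Λ^{Sᶜ}` of the other particles the
`|S|`-body function `Φ_{S,Y} = Ψ(· ⊔ Y)` on `Λ^{|S|}` satisfies
`⟨attraction⟩ ≤ ⟨kinetic⟩ + ⟨repulsion⟩ + B‖Φ_{S,Y}‖²`, then the part of `(H_Λ(ρ_μ))_M`
belonging to the group `S` (the forms `ρ_μ∑_{i∈S}∫w₁(xᵢ,y)dy`, `∑_{i∈S}T^{(i)}`,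
`∑_{i<i'∈S}w(xᵢ,x_{i'})`) satisfies the same inequality on `Ψ`, by integrating over `Y`
(Tonelli on `Λ^M ≃ Λ^{|S|} × Λ^{Sᶜ}`). [cite: Fournais2020, (2.12)–(2.14)] -/
theorem group_bound (hvm : Measurable v) (hω : Measurable ω) (hχ : IsLocalizationFunction χ)
    (ℓ ρμ s b : ℝ) (u : Space) {Ψ : Config M → ℂ} (hΨm : Measurable Ψ) (S : Finset (Fin M))
    (Bc : ℝ≥0∞) (hΨ2 : ∫⁻ X in boxConfig M ℓ u, (‖Ψ X‖₊ : ℝ≥0∞) ^ 2 ≠ ⊤)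
    (hfib : ∀ Y : {i // i ∉ S} → Space,
      (∫⁻ Z in boxConfig S.card ℓ u, (‖Ψ ((split[S]).symm (Z, Y))‖₊ : ℝ≥0∞) ^ 2) ≠ ⊤ →
      (∫⁻ Z in boxConfig S.card ℓ u,
          attrBoxN v ω χ ℓ ρμ u Z * (‖Ψ ((split[S]).symm (Z, Y))‖₊ : ℝ≥0∞) ^ 2) ≤
        kinBoxN χ ℓ s b u (fun Z => Ψ ((split[S]).symm (Z, Y))) +
          (∫⁻ Z in boxConfig S.card ℓ u,
            repBoxN v χ ℓ u Z * (‖Ψ ((split[S]).symm (Z, Y))‖₊ : ℝ≥0∞) ^ 2) +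
          Bc * ∫⁻ Z in boxConfig S.card ℓ u, (‖Ψ ((split[S]).symm (Z, Y))‖₊ : ℝ≥0∞) ^ 2) :
    (∫⁻ X in boxConfig M ℓ u,
        (ENNReal.ofReal ρμ * ∑ i ∈ S, ∫⁻ y, pairLoc₁ v ω χ ℓ u (X i) y) * (‖Ψ X‖₊ : ℝ≥0∞) ^ 2) ≤
      (∑ i ∈ S, (ENNReal.ofReal ℓ ^ 3)⁻¹ *
          ∫⁻ X in boxConfig M ℓ u, kinLoc χ ℓ s b u fun x => Ψ (Function.update X i x)) +
        (∫⁻ X in boxConfig M ℓ u,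
          (∑ i ∈ S, ∑ i' ∈ S with i < i', pairLoc v χ ℓ u (X i) (X i')) * (‖Ψ X‖₊ : ℝ≥0∞) ^ 2) +
        Bc * ∫⁻ X in boxConfig M ℓ u, (‖Ψ X‖₊ : ℝ≥0∞) ^ 2 := by
  have hχc : Continuous χ := hχ.contDiff.continuous
  set E : Set ({i // i ∉ S} → Space) := Set.univ.pi fun _ => slidingBox ℓ u with hEdef
  have hnorm : Measurable fun X : Config M => (‖Ψ X‖₊ : ℝ≥0∞) ^ 2 :=
    (hΨm.nnnorm.coe_nnreal_ennreal).pow_const _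
  -- the integrands on `Λ^M`
  set Fa : Config M → ℝ≥0∞ := fun X =>
    (ENNReal.ofReal ρμ * ∑ i ∈ S, ∫⁻ y, pairLoc₁ v ω χ ℓ u (X i) y) * (‖Ψ X‖₊ : ℝ≥0∞) ^ 2 with hFa
  set Fr : Config M → ℝ≥0∞ := fun X =>
    (∑ i ∈ S, ∑ i' ∈ S with i < i', pairLoc v χ ℓ u (X i) (X i')) * (‖Ψ X‖₊ : ℝ≥0∞) ^ 2 with hFr
  have hFam : Measurable Fa := (measurable_attr_group hvm hω hχ ℓ ρμ u S).mul hnorm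
  have hFrm : Measurable Fr := (measurable_rep_group hvm hχ ℓ u S).mul hnorm
  set K : Fin M → Config M → ℝ≥0∞ := fun i X => kinLoc χ ℓ s b u fun x => Ψ (Function.update X i x)
    with hKdef
  have hKm : ∀ i, Measurable (K i) := fun i => measurable_kinLoc_slice' hχc ℓ s b u i hΨm
  -- the fibre quantities
  set A : ({i // i ∉ S} → Space) → ℝ≥0∞ := fun Y => ∫⁻ Z in boxConfig S.card ℓ u,
    attrBoxN v ω χ ℓ ρμ u Z * (‖Ψ ((split[S]).symm (Z, Y))‖₊ : ℝ≥0∞) ^ 2 with hA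
  set Rr : ({i // i ∉ S} → Space) → ℝ≥0∞ := fun Y => ∫⁻ Z in boxConfig S.card ℓ u,
    repBoxN v χ ℓ u Z * (‖Ψ ((split[S]).symm (Z, Y))‖₊ : ℝ≥0∞) ^ 2 with hRr
  set Nm : ({i // i ∉ S} → Space) → ℝ≥0∞ := fun Y => ∫⁻ Z in boxConfig S.card ℓ u,
    (‖Ψ ((split[S]).symm (Z, Y))‖₊ : ℝ≥0∞) ^ 2 with hNm
  set Kn : ({i // i ∉ S} → Space) → ℝ≥0∞ := fun Y =>
    kinBoxN χ ℓ s b u (fun Z => Ψ ((split[S]).symm (Z, Y))) with hKn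
  -- measurability in `Y`
  have hRrm : Measurable Rr := by
    have h1 : Measurable fun q : Config S.card × ({i // i ∉ S} → Space) =>
        repBoxN v χ ℓ u q.1 * (‖Ψ ((split[S]).symm q)‖₊ : ℝ≥0∞) ^ 2 := by
      have h := ((measurable_repBoxN hvm hχ ℓ u).comp measurable_fst).mul
        (hnorm.comp (split[S]).symm.measurable)
      exact h
    have h := h1.lintegral_prod_left' (μ := (volume : Measure (Config S.card)).restrict (boxConfig S.card ℓ u))
    exact h
  have hNmm : Measurable Nm := by
    have h1 : Measurable fun q : Config S.card × ({i // i ∉ S} → Space) =>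
        (‖Ψ ((split[S]).symm q)‖₊ : ℝ≥0∞) ^ 2 := by
      have h := hnorm.comp (split[S]).symm.measurable
      exact h
    have h := h1.lintegral_prod_left' (μ := (volume : Measure (Config S.card)).restrict (boxConfig S.card ℓ u))
    exact h
  have hYm : ∀ i : Fin M, Measurable fun Y : {i // i ∉ S} → Space =>
      ∫⁻ Z in boxConfig S.card ℓ u, K i ((split[S]).symm (Z, Y)) := fun i => by
    have h := ((hKm i).comp (split[S]).symm.measurable).lintegral_prod_left'
      (μ := (volume : Measure (Config S.card)).restrict (boxConfig S.card ℓ u))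
    exact h
  have hKnm : Measurable Kn := by
    simp only [hKn, kinBoxN_split_symm]
    exact Finset.measurable_sum _ fun j _ => (hYm _).const_mul _
  -- the four identifications
  have hattr : (∫⁻ X in boxConfig M ℓ u, Fa X) = ∫⁻ Y in E, A Y := by
    rw [lintegral_boxConfig_eq S ℓ u hFam]
    refine lintegral_congr fun Y => lintegral_congr fun Z => ?_
    simp only [hFa]
    rw [attr_group_split_symm S ρμ Z Y]
  have hrep : (∫⁻ X in boxConfig M ℓ u, Fr X) = ∫⁻ Y in E, Rr Y := by
    rw [lintegral_boxConfig_eq S ℓ u hFrm]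
    refine lintegral_congr fun Y => lintegral_congr fun Z => ?_
    simp only [hFr]
    rw [rep_group_split_symm S Z Y]
  have hone : (∫⁻ X in boxConfig M ℓ u, (‖Ψ X‖₊ : ℝ≥0∞) ^ 2) = ∫⁻ Y in E, Nm Y :=
    lintegral_boxConfig_eq S ℓ u hnorm
  have hkin : (∑ i ∈ S, (ENNReal.ofReal ℓ ^ 3)⁻¹ * ∫⁻ X in boxConfig M ℓ u, K i X) =
      ∫⁻ Y in E, Kn Y := by
    simp only [hKn, kinBoxN_split_symm]
    rw [lintegral_finsetSum _ fun j _ => (hYm _).const_mul _]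
    simp only [lintegral_const_mul _ (hYm _)]
    rw [sum_mem_eq_sum_enum S]
    refine Finset.sum_congr rfl fun j _ => ?_
    rw [lintegral_boxConfig_eq S ℓ u (hKm _)]
  -- almost every fibre has finite norm
  have hfinY : (∫⁻ Y in E, Nm Y) ≠ ⊤ := by rwa [← hone]
  have hae : ∀ᵐ Y ∂(volume.restrict E), Nm Y < ⊤ := ae_lt_top hNmm hfinY
  -- integrate the fibre bounds
  have hmain : (∫⁻ Y in E, A Y) ≤ ∫⁻ Y in E, (Kn Y + Rr Y + Bc * Nm Y) := by
    refine lintegral_mono_ae ?_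
    filter_upwards [hae] with Y hY
    exact hfib Y hY.ne
  rw [lintegral_add_left (f := fun Y => Kn Y + Rr Y) (hKnm.add hRrm), lintegral_add_left hKnm,
    lintegral_const_mul _ hNmm, ← hkin, ← hrep, ← hone] at hmain
  rw [hattr]
  exact hmain

end GroupBound

/-! ### The sectors: cancellations in (2.43) ((2.48)–(2.50)) -/

section Sectors

/-- **(2.49) for a (last) group**: if the gap coefficient dominates, `b ℓ⁻² ≥ Ca((n+1)/ℓ³ + ρ_μ)`
(2.48), the `n₊`-terms of (2.43) cancel against the saved gap `bℓ⁻²⟨n₊⟩ ≤ ∑⟨T^{(i)}⟩`, and the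
positive square `2π(a/ℓ³)(ρ_μℓ³-n)²` may be dropped. [cite: Fournais2020, (2.48)–(2.49)] -/
theorem sector_bound_last {attr kin rep nrm N : ℝ≥0∞} {Sq g g' E : ℝ}
    (h243 : attr + ENNReal.ofReal Sq * nrm + ENNReal.ofReal g * N ≤
      kin + rep + ENNReal.ofReal g' * N + ENNReal.ofReal E * nrm)
    (hg : g' ≤ g) (hN : ENNReal.ofReal g * N ≤ kin) :
    attr ≤ kin + rep + ENNReal.ofReal E * nrm := by
  by_cases hkin : kin = ⊤
  · rw [hkin, top_add, top_add]; exact le_top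
  have hNfin : ENNReal.ofReal g * N ≠ ⊤ := ne_top_of_le_ne_top hkin hN
  have h1 : attr + ENNReal.ofReal g * N ≤
      (kin + rep + ENNReal.ofReal E * nrm) + ENNReal.ofReal g * N :=
    calc attr + ENNReal.ofReal g * N
        ≤ attr + ENNReal.ofReal Sq * nrm + ENNReal.ofReal g * N := by gcongr; exact le_self_add
      _ ≤ kin + rep + ENNReal.ofReal g' * N + ENNReal.ofReal E * nrm := h243
      _ ≤ kin + rep + ENNReal.ofReal g * N + ENNReal.ofReal E * nrm := by gcongr
      _ = (kin + rep + ENNReal.ofReal E * nrm) + ENNReal.ofReal g * N := by ring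
  exact ENNReal.le_of_add_le_add_right hNfin h1

/-- **(2.50) for a full group**: if moreover the error is dominated by the square,
`E ≤ 2π(a/ℓ³)(ρ_μℓ³-n)²`, then `⟨attraction⟩ ≤ ⟨kinetic⟩ + ⟨repulsion⟩` (`(H_Λ)_n ≥ 0`), for
states of finite norm. [cite: Fournais2020, (2.50)] -/
theorem sector_bound_full {attr kin rep nrm N : ℝ≥0∞} {Sq g g' E : ℝ}
    (h243 : attr + ENNReal.ofReal Sq * nrm + ENNReal.ofReal g * N ≤
      kin + rep + ENNReal.ofReal g' * N + ENNReal.ofReal E * nrm)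
    (hg : g' ≤ g) (hN : ENNReal.ofReal g * N ≤ kin) (hE : E ≤ Sq) (hnrm : nrm ≠ ⊤) :
    attr ≤ kin + rep := by
  by_cases hkin : kin = ⊤
  · rw [hkin, top_add]; exact le_top
  have hNfin : ENNReal.ofReal g * N ≠ ⊤ := ne_top_of_le_ne_top hkin hN
  have hSfin : ENNReal.ofReal Sq * nrm ≠ ⊤ := ENNReal.mul_ne_top ENNReal.ofReal_ne_top hnrm
  have h1 : attr + (ENNReal.ofReal Sq * nrm + ENNReal.ofReal g * N) ≤
      (kin + rep) + (ENNReal.ofReal Sq * nrm + ENNReal.ofReal g * N) :=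
    calc attr + (ENNReal.ofReal Sq * nrm + ENNReal.ofReal g * N)
        = attr + ENNReal.ofReal Sq * nrm + ENNReal.ofReal g * N := (add_assoc _ _ _).symm
      _ ≤ kin + rep + ENNReal.ofReal g' * N + ENNReal.ofReal E * nrm := h243
      _ ≤ kin + rep + ENNReal.ofReal g * N + ENNReal.ofReal Sq * nrm := by gcongr
      _ = (kin + rep) + (ENNReal.ofReal Sq * nrm + ENNReal.ofReal g * N) := by ring
  exact ENNReal.le_of_add_le_add_right (ENNReal.add_ne_top.2 ⟨hSfin, hNfin⟩) h1

end Sectors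

/-! ### Grouping of the particles (2.12)–(2.13) -/

section Grouping

variable {m q r : ℕ}

/-- **Sums over the particles, group by group**: for a labelling `Fin M ≃ (Fin m × Fin q) ⊕ Fin r`
of the particles by `q` groups of `m` and a last group of `r`,
`∑ᵢ fᵢ = ∑_t ∑_{i ∈ S_t} fᵢ + ∑_{i ∈ S_last} fᵢ`. [cite: Fournais2020, (2.12)] -/
theorem sum_eq_sum_groups (e : Fin M ≃ (Fin m × Fin q) ⊕ Fin r) (f : Fin M → ℝ≥0∞) :
    ∑ i, f i = (∑ t : Fin q, ∑ i ∈ Finset.univ.image (fun j : Fin m => e.symm (Sum.inl (j, t))), f i) +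
      ∑ i ∈ Finset.univ.image (fun j : Fin r => e.symm (Sum.inr j)), f i := by
  have hinl : ∀ t : Fin q, Function.Injective fun j : Fin m => e.symm (Sum.inl (j, t)) :=
    fun t j j' h => by simpa using h
  have hinr : Function.Injective fun j : Fin r => e.symm (Sum.inr j) := fun j j' h => by simpa using h
  simp only [Finset.sum_image fun j _ j' _ h => hinl _ h, Finset.sum_image fun j _ j' _ h => hinr h]
  rw [← e.symm.sum_comp, Fintype.sum_sum_type, Fintype.sum_prod_type, Finset.sum_comm]

/-- The groups have `m` particles. [cite: Fournais2020, (2.13)] -/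
theorem card_group (e : Fin M ≃ (Fin m × Fin q) ⊕ Fin r) (t : Fin q) :
    (Finset.univ.image (fun j : Fin m => e.symm (Sum.inl (j, t)))).card = m := by
  rw [Finset.card_image_of_injective _ (fun j j' h => by simpa using h), Finset.card_univ, Fintype.card_fin]

/-- The last group has `r` particles. [cite: Fournais2020, (2.13)] -/
theorem card_group_last (e : Fin M ≃ (Fin m × Fin q) ⊕ Fin r) :
    (Finset.univ.image (fun j : Fin r => e.symm (Sum.inr j))).card = r := by
  rw [Finset.card_image_of_injective _ (fun j j' h => by simpa using h), Finset.card_univ, Fintype.card_fin]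

/-- **Discarding the interaction between different groups** (2.14): the repulsion dominates the
sum of the repulsions within the groups (`w ≥ 0`). [cite: Fournais2020, (2.14)] -/
theorem sum_groups_le_pairSum (e : Fin M ≃ (Fin m × Fin q) ⊕ Fin r) (w : Fin M → Fin M → ℝ≥0∞) :
    (∑ t : Fin q, ∑ i ∈ Finset.univ.image (fun j : Fin m => e.symm (Sum.inl (j, t))),
        ∑ i' ∈ Finset.univ.image (fun j : Fin m => e.symm (Sum.inl (j, t))) with i < i', w i i') +
      ∑ i ∈ Finset.univ.image (fun j : Fin r => e.symm (Sum.inr j)),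
        ∑ i' ∈ Finset.univ.image (fun j : Fin r => e.symm (Sum.inr j)) with i < i', w i i' ≤
    ∑ i, ∑ i' : Fin M with i < i', w i i' := by
  rw [sum_eq_sum_groups e fun i => ∑ i' : Fin M with i < i', w i i']
  refine add_le_add (Finset.sum_le_sum fun t _ => Finset.sum_le_sum fun i _ => ?_)
    (Finset.sum_le_sum fun i _ => ?_) <;>
    exact Finset.sum_le_sum_of_subset (Finset.filter_subset_filter _ (Finset.subset_univ _))

end Grouping

/-! ### The regime `ℓ = K⁻¹(ρ_μa)^{-1/2}`, `ρ_μa³` small ((2.47)–(2.48)) -/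

section Regime

variable {K ρμ a : ℝ}

/-- `ℓ⁻² = K²ρ_μa` for `ℓ = K⁻¹(ρ_μa)^{-1/2}` (2.1). [cite: Fournais2020, (2.1)] -/
theorem boxLength_sq_inv (hρ : 0 < ρμ) (ha : 0 < a) :
    (boxLength K ρμ a ^ 2)⁻¹ = K ^ 2 * (ρμ * a) := by
  unfold boxLength
  rw [inv_pow, inv_inv, mul_pow, Real.sq_sqrt (mul_pos hρ ha).le]

/-- `ρ_μℓ³ = K⁻³(ρ_μa³)^{-1/2}` ("since, for `ρ_μa³` sufficiently small,
`ρ_μℓ³ = K⁻³(ρ_μa³)^{-1/2} ≥ 1`", p. 7). [cite: Fournais2020, (2.1), p. 7] -/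
theorem rho_mul_boxLength_cube (hK : 0 < K) (hρ : 0 < ρμ) (ha : 0 < a) :
    ρμ * boxLength K ρμ a ^ 3 = (K ^ 3 * Real.sqrt (ρμ * a ^ 3))⁻¹ := by
  have ht : 0 < Real.sqrt (ρμ * a) := Real.sqrt_pos.2 (mul_pos hρ ha)
  have ht2 : Real.sqrt (ρμ * a) ^ 2 = ρμ * a := Real.sq_sqrt (mul_pos hρ ha).le
  have h3 : Real.sqrt (ρμ * a ^ 3) = a * Real.sqrt (ρμ * a) := by
    rw [show ρμ * a ^ 3 = a ^ 2 * (ρμ * a) by ring, Real.sqrt_mul (sq_nonneg a), Real.sqrt_sq ha.le]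
  unfold boxLength
  rw [h3, inv_pow, mul_pow]
  field_simp
  nlinarith [ht2]

/-- `aρ_μ = K³ · ρ_μ²aℓ³ · (ρ_μa³)^{1/2}`: an error `-Cρ_μa` (2.47) is of the order
`-C₀ρ_μ²aℓ³(ρ_μa³)^{1/2}` of (2.11). [cite: Fournais2020, (2.47), (2.11)] -/
theorem a_mul_rho_eq (hK : 0 < K) (hρ : 0 < ρμ) (ha : 0 < a) :
    a * ρμ = K ^ 3 * (ρμ ^ 2 * a * boxLength K ρμ a ^ 3) * Real.sqrt (ρμ * a ^ 3) := by
  have hs : 0 < Real.sqrt (ρμ * a ^ 3) := Real.sqrt_pos.2 (by positivity)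
  rw [show ρμ ^ 2 * a * boxLength K ρμ a ^ 3 = ρμ * a * (ρμ * boxLength K ρμ a ^ 3) by ring,
    rho_mul_boxLength_cube hK hρ ha]
  field_simp

/-- `ρ_μℓR² = K⁻¹(R/a)²(ρ_μa³)^{1/2}` (the `R²`-error of (2.46) in (2.47)).
[cite: Fournais2020, (2.46)–(2.47)] -/
theorem rho_mul_boxLength_mul_sq (hK : 0 < K) (hρ : 0 < ρμ) (ha : 0 < a) (R : ℝ) :
    ρμ * boxLength K ρμ a * R ^ 2 = R ^ 2 * Real.sqrt (ρμ * a ^ 3) / (K * a ^ 2) := by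
  have ht : 0 < Real.sqrt (ρμ * a) := Real.sqrt_pos.2 (mul_pos hρ ha)
  have ht2 : Real.sqrt (ρμ * a) ^ 2 = ρμ * a := Real.sq_sqrt (mul_pos hρ ha).le
  have h3 : Real.sqrt (ρμ * a ^ 3) = a * Real.sqrt (ρμ * a) := by
    rw [show ρμ * a ^ 3 = a ^ 2 * (ρμ * a) by ring, Real.sqrt_mul (sq_nonneg a), Real.sqrt_sq ha.le]
  unfold boxLength
  rw [h3]
  field_simp
  nlinarith [ht2]

/-- **(2.48), the gap dominates**: for `n ≤ (Ξ+1)ρ_μℓ³` (`Ξ = 3`), `ρ_μℓ³ ≥ 1` and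
`K² ≥ 12C/b`, `Ca((n+1)/ℓ³ + ρ_μ) ≤ bℓ⁻²`. [cite: Fournais2020, (2.45), (2.48)] -/
theorem gap_bound {C b ℓ : ℝ} {n : ℕ} (hC : 0 ≤ C) (ha : 0 < a) (hρ : 0 < ρμ) (hℓ : 0 < ℓ)
    (hℓ2 : (ℓ ^ 2)⁻¹ = K ^ 2 * (ρμ * a)) (hρℓ : 1 ≤ ρμ * ℓ ^ 3) (hKb : 12 * C ≤ b * K ^ 2)
    (hn : (n : ℝ) ≤ 4 * (ρμ * ℓ ^ 3)) :
    C * a * ((n + 1) / ℓ ^ 3 + ρμ) ≤ b / ℓ ^ 2 := by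
  have hℓ3 : 0 < ℓ ^ 3 := by positivity
  have h1 : (n + 1) / ℓ ^ 3 ≤ 5 * ρμ := by
    rw [div_le_iff₀ hℓ3]; nlinarith
  have h2 : b / ℓ ^ 2 = b * K ^ 2 * (ρμ * a) := by rw [div_eq_mul_inv, hℓ2]; ring
  rw [h2]
  calc C * a * ((n + 1) / ℓ ^ 3 + ρμ) ≤ C * a * (6 * ρμ) := by gcongr; linarith
    _ = 6 * C * (ρμ * a) := by ring
    _ ≤ b * K ^ 2 * (ρμ * a) :=
        mul_le_mul_of_nonneg_right (by linarith) (mul_pos hρ ha).le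

/-- **(2.47), the error terms**: for `n ≤ (Ξ+1)ρ_μℓ³` (`Ξ = 3`), `ρ_μℓ³ ≥ 1`, `K ≥ 1`,
`ρ_μa³ ≤ 1`: `4πaρ_μ²ℓ³ + Cnaℓ⁻³(1 + a²(n+1)²/ℓ² + (n+1)R²/ℓ²) + Caρ_μ ≤ 4πaρ_μ²ℓ³ + C(105 + 20(R/a)²)·aρ_μ`
(`a²(n+1)²/ℓ² ≤ 25K⁻⁴`, `(n+1)R²/ℓ² ≤ 5ρ_μℓR² = 5K⁻¹(R/a)²(ρ_μa³)^{1/2}`).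
[cite: Fournais2020, (2.46)–(2.47)] -/
theorem error_bound {C ℓ R : ℝ} {n : ℕ} (hC : 0 ≤ C) (ha : 0 < a) (hρ : 0 < ρμ) (hℓ : 0 < ℓ)
    (hK : 1 ≤ K) (hℓ2 : (ℓ ^ 2)⁻¹ = K ^ 2 * (ρμ * a)) (hρℓ : 1 ≤ ρμ * ℓ ^ 3)
    (hρℓR : ρμ * ℓ * R ^ 2 = R ^ 2 * Real.sqrt (ρμ * a ^ 3) / (K * a ^ 2))
    (hsq1 : Real.sqrt (ρμ * a ^ 3) ≤ 1) (hn : (n : ℝ) ≤ 4 * (ρμ * ℓ ^ 3)) :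
    4 * Real.pi * a * ρμ ^ 2 * ℓ ^ 3 +
        C * n * a / ℓ ^ 3 * (1 + a ^ 2 * (n + 1) ^ 2 / ℓ ^ 2 + (n + 1) * R ^ 2 / ℓ ^ 2) + C * a * ρμ ≤
      4 * Real.pi * a * ρμ ^ 2 * ℓ ^ 3 + C * (105 + 20 * (R / a) ^ 2) * (a * ρμ) := by
  have hℓ3 : 0 < ℓ ^ 3 := by positivity
  have hn0 : (0 : ℝ) ≤ n := Nat.cast_nonneg n
  have hn1 : (n : ℝ) + 1 ≤ 5 * (ρμ * ℓ ^ 3) := by linarith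
  have hℓ2' : ℓ ^ 2 = (K ^ 2 * (ρμ * a))⁻¹ := by rw [← hℓ2, inv_inv]
  -- `n/ℓ³ ≤ 4ρ_μ`
  have hA : C * n * a / ℓ ^ 3 ≤ 4 * C * a * ρμ := by
    rw [div_le_iff₀ hℓ3]
    have : C * a * n ≤ C * a * (4 * (ρμ * ℓ ^ 3)) := by gcongr
    nlinarith
  -- `a²(n+1)²/ℓ² ≤ 25`
  have hB : a ^ 2 * (n + 1) ^ 2 / ℓ ^ 2 ≤ 25 := by
    have h1 : ((n : ℝ) + 1) ^ 2 ≤ 25 * (ρμ * ℓ ^ 3) ^ 2 := by nlinarith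
    have h2 : a ^ 2 * (n + 1) ^ 2 / ℓ ^ 2 ≤ a ^ 2 * (25 * (ρμ * ℓ ^ 3) ^ 2) / ℓ ^ 2 := by gcongr
    have h3 : a ^ 2 * (25 * (ρμ * ℓ ^ 3) ^ 2) / ℓ ^ 2 = 25 * (a * ρμ * ℓ ^ 2) ^ 2 := by
      field_simp
    have h4 : a * ρμ * ℓ ^ 2 = (K ^ 2)⁻¹ := by
      rw [hℓ2']; field_simp
    have h5 : (K ^ 2)⁻¹ ≤ 1 := inv_le_one_of_one_le₀ (by nlinarith)
    have h6 : 0 ≤ (K ^ 2)⁻¹ := by positivity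
    calc a ^ 2 * (n + 1) ^ 2 / ℓ ^ 2 ≤ 25 * (a * ρμ * ℓ ^ 2) ^ 2 := h2.trans h3.le
      _ = 25 * ((K ^ 2)⁻¹) ^ 2 := by rw [h4]
      _ ≤ 25 * 1 := by gcongr; nlinarith
      _ = 25 := by ring
  -- `(n+1)R²/ℓ² ≤ 5(R/a)²`
  have hCst : (n + 1) * R ^ 2 / ℓ ^ 2 ≤ 5 * (R / a) ^ 2 := by
    have h1 : (n + 1) * R ^ 2 / ℓ ^ 2 ≤ 5 * (ρμ * ℓ ^ 3) * R ^ 2 / ℓ ^ 2 := by gcongr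
    have h2 : 5 * (ρμ * ℓ ^ 3) * R ^ 2 / ℓ ^ 2 = 5 * (ρμ * ℓ * R ^ 2) := by
      field_simp
    have h3 : ρμ * ℓ * R ^ 2 ≤ (R / a) ^ 2 := by
      rw [hρℓR, div_pow]
      rw [div_le_div_iff₀ (by positivity) (by positivity)]
      have hR2 : 0 ≤ R ^ 2 := sq_nonneg R
      have : R ^ 2 * Real.sqrt (ρμ * a ^ 3) * a ^ 2 ≤ R ^ 2 * 1 * (K * a ^ 2) := by
        have h4 : R ^ 2 * Real.sqrt (ρμ * a ^ 3) ≤ R ^ 2 * 1 := by gcongr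
        have h5 : a ^ 2 ≤ K * a ^ 2 := by nlinarith [sq_nonneg a]
        exact mul_le_mul h4 h5 (by positivity) (by positivity)
      linarith
    calc (n + 1) * R ^ 2 / ℓ ^ 2 ≤ 5 * (ρμ * ℓ * R ^ 2) := h1.trans h2.le
      _ ≤ 5 * (R / a) ^ 2 := by gcongr
  -- combine
  have hmid : C * n * a / ℓ ^ 3 * (1 + a ^ 2 * (n + 1) ^ 2 / ℓ ^ 2 + (n + 1) * R ^ 2 / ℓ ^ 2) ≤
      4 * C * a * ρμ * (26 + 5 * (R / a) ^ 2) := by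
    have h0 : 0 ≤ C * n * a / ℓ ^ 3 := by positivity
    have h1 : 1 + a ^ 2 * (n + 1) ^ 2 / ℓ ^ 2 + (n + 1) * R ^ 2 / ℓ ^ 2 ≤ 26 + 5 * (R / a) ^ 2 := by
      linarith
    have h2 : 0 ≤ 1 + a ^ 2 * (n + 1) ^ 2 / ℓ ^ 2 + (n + 1) * R ^ 2 / ℓ ^ 2 := by positivity
    exact mul_le_mul hA h1 h2 (by positivity)
  nlinarith [hmid, mul_pos ha hρ, sq_nonneg (R / a)]

/-- **(2.50), a full group is non-negative**: for `n ≥ Ξρ_μℓ³` (`Ξ = 3`),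
`2π(a/ℓ³)(ρ_μℓ³ - n)² ≥ 8πaρ_μ²ℓ³ ≥ 4πaρ_μ²ℓ³(1 + C₀x)` as soon as `C₀x ≤ 1`
(`x = (ρ_μa³)^{1/2}`). [cite: Fournais2020, (2.50)] -/
theorem full_bound {ℓ C₀ x : ℝ} {n : ℕ} (ha : 0 ≤ a) (hρ : 0 ≤ ρμ) (hℓ : 0 < ℓ)
    (hn : 3 * (ρμ * ℓ ^ 3) ≤ n) (hC₀x : C₀ * x ≤ 1) :
    4 * Real.pi * a * ρμ ^ 2 * ℓ ^ 3 * (1 + C₀ * x) ≤ 2 * Real.pi * (a / ℓ ^ 3) * (ρμ * ℓ ^ 3 - n) ^ 2 := by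
  have hρℓ : 0 ≤ ρμ * ℓ ^ 3 := by positivity
  have h1 : 2 * (ρμ * ℓ ^ 3) ≤ n - ρμ * ℓ ^ 3 := by linarith
  have h2 : (2 * (ρμ * ℓ ^ 3)) ^ 2 ≤ (ρμ * ℓ ^ 3 - n) ^ 2 := by nlinarith
  have h3 : 2 * Real.pi * (a / ℓ ^ 3) * (2 * (ρμ * ℓ ^ 3)) ^ 2 = 4 * Real.pi * a * ρμ ^ 2 * ℓ ^ 3 * 2 := by
    field_simp
    ring
  have h0 : 0 ≤ 4 * Real.pi * a * ρμ ^ 2 * ℓ ^ 3 := by positivity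
  calc 4 * Real.pi * a * ρμ ^ 2 * ℓ ^ 3 * (1 + C₀ * x)
      ≤ 4 * Real.pi * a * ρμ ^ 2 * ℓ ^ 3 * 2 := by gcongr; linarith
    _ = 2 * Real.pi * (a / ℓ ^ 3) * (2 * (ρμ * ℓ ^ 3)) ^ 2 := h3.symm
    _ ≤ 2 * Real.pi * (a / ℓ ^ 3) * (ρμ * ℓ ^ 3 - n) ^ 2 := by gcongr

end Regime

/-! ### Assembly: Theorem 2.1 from (2.43) -/

section Assembly

variable {χ : Space → ℝ} {v : ℝ → ℝ≥0∞} {ω : Space → ℝ}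

/-- The attraction of `Λ^M`, group by group (linearity of `∑ᵢ` and of the integral).
[cite: Fournais2020, (2.14)] -/
theorem lintegral_attr_groups {m q r : ℕ} (hvm : Measurable v) (hω : Measurable ω)
    (hχ : IsLocalizationFunction χ) (ℓ ρμ : ℝ) (u : Space) {Φ : Config M → ℂ} (hΦm : Measurable Φ)
    (e : Fin M ≃ (Fin m × Fin q) ⊕ Fin r) :
    (∫⁻ X in boxConfig M ℓ u, attrBoxN v ω χ ℓ ρμ u X * (‖Φ X‖₊ : ℝ≥0∞) ^ 2) =
      (∑ t : Fin q, ∫⁻ X in boxConfig M ℓ u,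
        (ENNReal.ofReal ρμ * ∑ i ∈ Finset.univ.image (fun j : Fin m => e.symm (Sum.inl (j, t))),
          ∫⁻ y, pairLoc₁ v ω χ ℓ u (X i) y) * (‖Φ X‖₊ : ℝ≥0∞) ^ 2) +
      ∫⁻ X in boxConfig M ℓ u,
        (ENNReal.ofReal ρμ * ∑ i ∈ Finset.univ.image (fun j : Fin r => e.symm (Sum.inr j)),
          ∫⁻ y, pairLoc₁ v ω χ ℓ u (X i) y) * (‖Φ X‖₊ : ℝ≥0∞) ^ 2 := by
  have hnorm : Measurable fun X : Config M => (‖Φ X‖₊ : ℝ≥0∞) ^ 2 :=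
    (hΦm.nnnorm.coe_nnreal_ennreal).pow_const _
  have hmeas : ∀ S : Finset (Fin M), Measurable fun X : Config M =>
      (ENNReal.ofReal ρμ * ∑ i ∈ S, ∫⁻ y, pairLoc₁ v ω χ ℓ u (X i) y) * (‖Φ X‖₊ : ℝ≥0∞) ^ 2 :=
    fun S => (measurable_attr_group hvm hω hχ ℓ ρμ u S).mul hnorm
  rw [← lintegral_finsetSum _ fun t _ => hmeas _, ← lintegral_add_right _ (hmeas _)]
  refine lintegral_congr fun X => ?_
  unfold attrBoxN
  rw [sum_eq_sum_groups e fun i => ∫⁻ y, pairLoc₁ v ω χ ℓ u (X i) y, mul_add, add_mul,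
    Finset.mul_sum, Finset.sum_mul]

/-- The repulsion of `Λ^M` dominates the repulsions within the groups.
[cite: Fournais2020, (2.14)] -/
theorem sum_lintegral_rep_groups_le {m q r : ℕ} (hvm : Measurable v) (hχ : IsLocalizationFunction χ)
    (ℓ : ℝ) (u : Space) {Φ : Config M → ℂ} (hΦm : Measurable Φ)
    (e : Fin M ≃ (Fin m × Fin q) ⊕ Fin r) :
    (∑ t : Fin q, ∫⁻ X in boxConfig M ℓ u,
        (∑ i ∈ Finset.univ.image (fun j : Fin m => e.symm (Sum.inl (j, t))),
          ∑ i' ∈ Finset.univ.image (fun j : Fin m => e.symm (Sum.inl (j, t))) with i < i',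
            pairLoc v χ ℓ u (X i) (X i')) * (‖Φ X‖₊ : ℝ≥0∞) ^ 2) +
      (∫⁻ X in boxConfig M ℓ u,
        (∑ i ∈ Finset.univ.image (fun j : Fin r => e.symm (Sum.inr j)),
          ∑ i' ∈ Finset.univ.image (fun j : Fin r => e.symm (Sum.inr j)) with i < i',
            pairLoc v χ ℓ u (X i) (X i')) * (‖Φ X‖₊ : ℝ≥0∞) ^ 2) ≤
      ∫⁻ X in boxConfig M ℓ u, repBoxN v χ ℓ u X * (‖Φ X‖₊ : ℝ≥0∞) ^ 2 := by
  have hnorm : Measurable fun X : Config M => (‖Φ X‖₊ : ℝ≥0∞) ^ 2 :=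
    (hΦm.nnnorm.coe_nnreal_ennreal).pow_const _
  have hmeas : ∀ S : Finset (Fin M), Measurable fun X : Config M =>
      (∑ i ∈ S, ∑ i' ∈ S with i < i', pairLoc v χ ℓ u (X i) (X i')) * (‖Φ X‖₊ : ℝ≥0∞) ^ 2 :=
    fun S => (measurable_rep_group hvm hχ ℓ u S).mul hnorm
  rw [← lintegral_finsetSum _ fun t _ => hmeas _, ← lintegral_add_right _ (hmeas _)]
  refine lintegral_mono fun X => ?_
  rw [← Finset.sum_mul, ← add_mul]
  refine mul_le_mul_left ?_ _
  unfold repBoxN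
  exact sum_groups_le_pairSum e fun i i' => pairLoc v χ ℓ u (X i) (X i')

/-- **Fournais 2020, Theorem 2.1 from the `n`-particle bound (2.43).** The bound
`(H_Λ(ρ_μ))_n ≥ E_Main + E_gap + E_error` [Fournais2020, (2.43)–(2.46)] (`Fournais2020_eq243`,
from Lemmas 2.3–2.4) implies the small-box theorem [Fournais2020, Thm. 2.1]: with `Ξ = 3`,
`K₀ = max(1, (12C/b)^{1/2})` and `ρ_μa³ ≤ min(K⁻⁶, (c₁/(RK))²a², C₀⁻², 1)` — so that
`ρ_μℓ³ ≥ 1`, `R ≤ c₁ℓ` and the full groups are non-negative — the `M` particles are divided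
into groups of `m = ⌈3ρ_μℓ³⌉ ≤ 4ρ_μℓ³` and a last group of fewer than `m` (2.12)–(2.13), the
interaction between the groups is dropped (2.14), each full group contributes `≥ 0` (2.50) and
the last one `≥ -4πaρ_μ²ℓ³(1 + C₀(ρ_μa³)^{1/2})` (2.49), (2.47), with
`C₀ = CK³(105 + 20(R/a)²)/(4π)`. [cite: Fournais2020, Thm. 2.1, (2.11)–(2.14), (2.43)–(2.50)] -/
theorem Fournais2020_thm21_of_eq243 (h243 : Fournais2020_eq243) : Fournais2020_thm21 := by
  intro v hv hint ha ω hω χ hχ b s hb hs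
  obtain ⟨hvmeas, R₀, hR₀⟩ := hv
  have ha0 : 0 < (scatteringLength v).toReal := scatteringLength_toReal_pos hint ha
  set R : ℝ := max R₀ 0 + 1 with hRdef
  have hRpos : 0 < R := by have := le_max_right R₀ 0; linarith
  have hR : ∀ r, R < r → v r = 0 := fun r hr => hR₀ r (by have := le_max_left R₀ 0; linarith)
  obtain ⟨C, c₁, hC, hc₁, H⟩ := h243 v ⟨hvmeas, R₀, hR₀⟩ hint ha ω hω χ hχ b s hb hs R hRpos hR
  -- `K₀ ≥ 1` with `bK₀² ≥ 12C`
  set K₀ : ℝ := max 1 (Real.sqrt (12 * C / b)) with hK₀def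
  have hK₀1 : 1 ≤ K₀ := le_max_left _ _
  refine ⟨K₀, by linarith, fun K hK => ?_⟩
  have hK1 : 1 ≤ K := hK₀1.trans hK
  have hKpos : 0 < K := by linarith
  have hKb : 12 * C ≤ b * K ^ 2 := by
    have h1 : Real.sqrt (12 * C / b) ≤ K := (le_max_right _ _).trans hK
    have h2 : 12 * C / b ≤ K ^ 2 := by
      have h3 := Real.sq_sqrt (by positivity : 0 ≤ 12 * C / b)
      nlinarith [Real.sqrt_nonneg (12 * C / b)]
    rw [div_le_iff₀ hb] at h2
    linarith
  set a : ℝ := (scatteringLength v).toReal with hadef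
  set C₀ : ℝ := C * K ^ 3 * (105 + 20 * (R / a) ^ 2) / (4 * Real.pi) with hC₀def
  have hC₀ : 0 < C₀ := by positivity
  set c : ℝ := min (min (K ^ 6)⁻¹ ((c₁ / (R * K)) ^ 2 * a ^ 2)) (min (C₀ ^ 2)⁻¹ 1) with hcdef
  have hc : 0 < c := by positivity
  refine ⟨C₀, c, hC₀, hc, ?_⟩
  intro ρμ hρμ
  dsimp only
  intro hρc M u Φ hΦm hΦs
  set ℓ : ℝ := boxLength K ρμ a with hℓdef
  -- the regime
  have hρc1 : ρμ * a ^ 3 ≤ (K ^ 6)⁻¹ := hρc.trans ((min_le_left _ _).trans (min_le_left _ _))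
  have hρc2 : ρμ * a ^ 3 ≤ (c₁ / (R * K)) ^ 2 * a ^ 2 :=
    hρc.trans ((min_le_left _ _).trans (min_le_right _ _))
  have hρc3 : ρμ * a ^ 3 ≤ (C₀ ^ 2)⁻¹ := hρc.trans ((min_le_right _ _).trans (min_le_left _ _))
  have hρc4 : ρμ * a ^ 3 ≤ 1 := hρc.trans ((min_le_right _ _).trans (min_le_right _ _))
  have hsq : 0 < Real.sqrt (ρμ * a) := Real.sqrt_pos.2 (by positivity)
  have hℓ0 : 0 < ℓ := by rw [hℓdef, boxLength]; positivity
  have hℓ2 : (ℓ ^ 2)⁻¹ = K ^ 2 * (ρμ * a) := boxLength_sq_inv hρμ ha0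
  have hρℓ3 : ρμ * ℓ ^ 3 = (K ^ 3 * Real.sqrt (ρμ * a ^ 3))⁻¹ := rho_mul_boxLength_cube hKpos hρμ ha0
  have hsqrt_pos : 0 < Real.sqrt (ρμ * a ^ 3) := Real.sqrt_pos.2 (by positivity)
  have hsq1 : Real.sqrt (ρμ * a ^ 3) ≤ 1 := Real.sqrt_le_one.mpr hρc4
  have hρℓ : 1 ≤ ρμ * ℓ ^ 3 := by
    rw [hρℓ3, one_le_inv_iff₀]
    refine ⟨by positivity, ?_⟩
    have h1 : Real.sqrt (ρμ * a ^ 3) ≤ (K ^ 3)⁻¹ := by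
      rw [← Real.sqrt_sq (by positivity : 0 ≤ (K ^ 3)⁻¹)]
      exact Real.sqrt_le_sqrt (by rw [inv_pow, ← pow_mul]; exact hρc1)
    calc K ^ 3 * Real.sqrt (ρμ * a ^ 3) ≤ K ^ 3 * (K ^ 3)⁻¹ := by gcongr
      _ = 1 := mul_inv_cancel₀ (by positivity)
  have hRℓ : R ≤ c₁ * ℓ := by
    have h1 : ρμ * a ≤ (c₁ / (R * K)) ^ 2 := by
      have h3 : ρμ * a * a ^ 2 ≤ (c₁ / (R * K)) ^ 2 * a ^ 2 := by nlinarith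
      exact le_of_mul_le_mul_right h3 (by positivity)
    have h4 : Real.sqrt (ρμ * a) ≤ c₁ / (R * K) := by
      rw [← Real.sqrt_sq (by positivity : 0 ≤ c₁ / (R * K))]
      exact Real.sqrt_le_sqrt h1
    rw [hℓdef, boxLength]
    rw [← div_le_iff₀' hc₁, le_inv_comm₀ (by positivity) (by positivity)]
    calc K * Real.sqrt (ρμ * a) ≤ K * (c₁ / (R * K)) := by gcongr
      _ = (R / c₁)⁻¹ := by field_simp
  have haρ : a * ρμ = K ^ 3 * (ρμ ^ 2 * a * ℓ ^ 3) * Real.sqrt (ρμ * a ^ 3) :=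
    a_mul_rho_eq hKpos hρμ ha0
  have hρℓR : ρμ * ℓ * R ^ 2 = R ^ 2 * Real.sqrt (ρμ * a ^ 3) / (K * a ^ 2) :=
    rho_mul_boxLength_mul_sq hKpos hρμ ha0 R
  have hC₀sq : C₀ * Real.sqrt (ρμ * a ^ 3) ≤ 1 := by
    have h1 : Real.sqrt (ρμ * a ^ 3) ≤ C₀⁻¹ := by
      rw [← Real.sqrt_sq (by positivity : 0 ≤ C₀⁻¹)]
      exact Real.sqrt_le_sqrt (by rw [inv_pow]; exact hρc3)
    calc C₀ * Real.sqrt (ρμ * a ^ 3) ≤ C₀ * C₀⁻¹ := by gcongr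
      _ = 1 := mul_inv_cancel₀ hC₀.ne'
  -- the constant of (2.11) and the error bound (2.47)
  set Bl : ℝ := 4 * Real.pi * ρμ ^ 2 * a * ℓ ^ 3 * (1 + C₀ * (ρμ * a ^ 3) ^ (1 / 2 : ℝ)) with hBldef
  have hBl_eq : 4 * Real.pi * a * ρμ ^ 2 * ℓ ^ 3 + C * (105 + 20 * (R / a) ^ 2) * (a * ρμ) = Bl := by
    rw [hBldef, ← Real.sqrt_eq_rpow, haρ, hC₀def]
    field_simp
  have hBl_eq' : 4 * Real.pi * a * ρμ ^ 2 * ℓ ^ 3 * (1 + C₀ * Real.sqrt (ρμ * a ^ 3)) = Bl := by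
    rw [hBldef, ← Real.sqrt_eq_rpow]; ring
  have hE : ∀ n : ℕ, (n : ℝ) ≤ 4 * (ρμ * ℓ ^ 3) →
      4 * Real.pi * a * ρμ ^ 2 * ℓ ^ 3 +
          C * n * a / ℓ ^ 3 * (1 + a ^ 2 * (n + 1) ^ 2 / ℓ ^ 2 + (n + 1) * R ^ 2 / ℓ ^ 2) + C * a * ρμ ≤ Bl :=
    fun n hn => (error_bound hC.le ha0 hρμ hℓ0 hK1 hℓ2 hρℓ hρℓR hsq1 hn).trans hBl_eq.le
  have hgap : ∀ n : ℕ, (n : ℝ) ≤ 4 * (ρμ * ℓ ^ 3) → C * a * ((n + 1) / ℓ ^ 3 + ρμ) ≤ b / ℓ ^ 2 :=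
    fun n hn => gap_bound hC.le ha0 hρμ hℓ0 hℓ2 hρℓ hKb hn
  have hfullsq : ∀ n : ℕ, 3 * (ρμ * ℓ ^ 3) ≤ n → Bl ≤ 2 * Real.pi * (a / ℓ ^ 3) * (ρμ * ℓ ^ 3 - n) ^ 2 :=
    fun n hn => hBl_eq'.symm.le.trans (full_bound ha0.le hρμ.le hℓ0 hn hC₀sq)
  -- (2.43) on the sectors of the box `Λ(u)`
  have HΦ : ∀ (n : ℕ) (Φ' : Config n → ℂ), Measurable Φ' →
      (∀ (σ : Equiv.Perm (Fin n)) (X : Config n), Φ' (X ∘ σ) = Φ' X) →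
      (∫⁻ X in boxConfig n ℓ u, attrBoxN v ω χ ℓ ρμ u X * (‖Φ' X‖₊ : ℝ≥0∞) ^ 2) +
          ENNReal.ofReal (2 * Real.pi * (a / ℓ ^ 3) * (ρμ * ℓ ^ 3 - n) ^ 2) *
            (∫⁻ X in boxConfig n ℓ u, (‖Φ' X‖₊ : ℝ≥0∞) ^ 2) +
          ENNReal.ofReal (b / ℓ ^ 2) * nPlusBoxN ℓ u Φ' ≤
        kinBoxN χ ℓ s b u Φ' +
          (∫⁻ X in boxConfig n ℓ u, repBoxN v χ ℓ u X * (‖Φ' X‖₊ : ℝ≥0∞) ^ 2) +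
          ENNReal.ofReal (C * a * ((n + 1) / ℓ ^ 3 + ρμ)) * nPlusBoxN ℓ u Φ' +
          ENNReal.ofReal (4 * Real.pi * a * ρμ ^ 2 * ℓ ^ 3 +
              C * n * a / ℓ ^ 3 * (1 + a ^ 2 * (n + 1) ^ 2 / ℓ ^ 2 + (n + 1) * R ^ 2 / ℓ ^ 2) +
              C * a * ρμ) *
            ∫⁻ X in boxConfig n ℓ u, (‖Φ' X‖₊ : ℝ≥0∞) ^ 2 :=
    fun n Φ' h1 h2 => H ℓ ρμ hℓ0 hρμ hRℓ n u Φ' h1 h2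
  -- states of infinite norm
  have hnorm : Measurable fun X : Config M => (‖Φ X‖₊ : ℝ≥0∞) ^ 2 :=
    (hΦm.nnnorm.coe_nnreal_ennreal).pow_const _
  have hBlpos : 0 < Bl := by
    rw [← hBl_eq']
    have : 0 ≤ C₀ * Real.sqrt (ρμ * a ^ 3) := by positivity
    positivity
  by_cases hΦ2 : (∫⁻ X in boxConfig M ℓ u, (‖Φ X‖₊ : ℝ≥0∞) ^ 2) = ⊤
  · rw [hΦ2, ENNReal.mul_top (by rwa [Ne, ENNReal.ofReal_eq_zero, not_le]), add_top]
    exact le_top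
  -- the grouping (2.12)–(2.13): `m = ⌈3ρ_μℓ³⌉ ∈ [3ρ_μℓ³, 4ρ_μℓ³]`, `M = mq + r`, `r < m`
  set m : ℕ := ⌈3 * (ρμ * ℓ ^ 3)⌉₊ with hmdef
  have hm3 : 3 * (ρμ * ℓ ^ 3) ≤ m := Nat.le_ceil _
  have hm4 : (m : ℝ) ≤ 4 * (ρμ * ℓ ^ 3) := by
    have := Nat.ceil_lt_add_one (by positivity : 0 ≤ 3 * (ρμ * ℓ ^ 3))
    rw [← hmdef] at this
    linarith
  have hmpos : 0 < m := by
    have : (0 : ℝ) < m := by linarith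
    exact_mod_cast this
  set q : ℕ := M / m with hqdef
  set r : ℕ := M % m with hrdef
  have hMmr : m * q + r = M := Nat.div_add_mod M m
  have hr : r < m := Nat.mod_lt _ hmpos
  have hr4 : (r : ℝ) ≤ 4 * (ρμ * ℓ ^ 3) := by
    have : (r : ℝ) ≤ m := by exact_mod_cast hr.le
    linarith
  let e : Fin M ≃ (Fin m × Fin q) ⊕ Fin r :=
    (finCongr hMmr.symm).trans (finSumFinEquiv.symm.trans (Equiv.sumCongr finProdFinEquiv.symm (Equiv.refl _)))
  -- the bounds on the groups
  have hfull : ∀ t : Fin q,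
      (∫⁻ X in boxConfig M ℓ u,
        (ENNReal.ofReal ρμ * ∑ i ∈ Finset.univ.image (fun j : Fin m => e.symm (Sum.inl (j, t))),
          ∫⁻ y, pairLoc₁ v ω χ ℓ u (X i) y) * (‖Φ X‖₊ : ℝ≥0∞) ^ 2) ≤
      (∑ i ∈ Finset.univ.image (fun j : Fin m => e.symm (Sum.inl (j, t))), (ENNReal.ofReal ℓ ^ 3)⁻¹ *
          ∫⁻ X in boxConfig M ℓ u, kinLoc χ ℓ s b u fun x => Φ (Function.update X i x)) +
        (∫⁻ X in boxConfig M ℓ u,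
          (∑ i ∈ Finset.univ.image (fun j : Fin m => e.symm (Sum.inl (j, t))),
            ∑ i' ∈ Finset.univ.image (fun j : Fin m => e.symm (Sum.inl (j, t))) with i < i',
              pairLoc v χ ℓ u (X i) (X i')) * (‖Φ X‖₊ : ℝ≥0∞) ^ 2) +
        0 * ∫⁻ X in boxConfig M ℓ u, (‖Φ X‖₊ : ℝ≥0∞) ^ 2 := by
    intro t
    set S := Finset.univ.image (fun j : Fin m => e.symm (Sum.inl (j, t))) with hSdef
    have hcard : S.card = m := card_group e t
    refine group_bound hvmeas hω.measurable hχ ℓ ρμ s b u hΦm S 0 hΦ2 fun Y hY => ?_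
    have h := HΦ S.card (fun Z => Φ ((split[S]).symm (Z, Y)))
      (measurable_split_symm_left S hΦm Y) (symm_split_symm_left S hΦs Y)
    rw [zero_mul, add_zero]
    have hn4 : (S.card : ℝ) ≤ 4 * (ρμ * ℓ ^ 3) := by rw [hcard]; exact hm4
    have hn3 : 3 * (ρμ * ℓ ^ 3) ≤ S.card := by rw [hcard]; exact hm3
    exact sector_bound_full h (hgap _ hn4) (nPlusBoxN_le_kinBoxN χ ℓ s b u _)
      ((hE _ hn4).trans (hfullsq _ hn3)) hY
  have hlast :
      (∫⁻ X in boxConfig M ℓ u,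
        (ENNReal.ofReal ρμ * ∑ i ∈ Finset.univ.image (fun j : Fin r => e.symm (Sum.inr j)),
          ∫⁻ y, pairLoc₁ v ω χ ℓ u (X i) y) * (‖Φ X‖₊ : ℝ≥0∞) ^ 2) ≤
      (∑ i ∈ Finset.univ.image (fun j : Fin r => e.symm (Sum.inr j)), (ENNReal.ofReal ℓ ^ 3)⁻¹ *
          ∫⁻ X in boxConfig M ℓ u, kinLoc χ ℓ s b u fun x => Φ (Function.update X i x)) +
        (∫⁻ X in boxConfig M ℓ u,
          (∑ i ∈ Finset.univ.image (fun j : Fin r => e.symm (Sum.inr j)),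
            ∑ i' ∈ Finset.univ.image (fun j : Fin r => e.symm (Sum.inr j)) with i < i',
              pairLoc v χ ℓ u (X i) (X i')) * (‖Φ X‖₊ : ℝ≥0∞) ^ 2) +
        ENNReal.ofReal Bl * ∫⁻ X in boxConfig M ℓ u, (‖Φ X‖₊ : ℝ≥0∞) ^ 2 := by
    set S := Finset.univ.image (fun j : Fin r => e.symm (Sum.inr j)) with hSdef
    have hcard : S.card = r := card_group_last e
    refine group_bound hvmeas hω.measurable hχ ℓ ρμ s b u hΦm S (ENNReal.ofReal Bl) hΦ2 fun Y _ => ?_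
    have h := HΦ S.card (fun Z => Φ ((split[S]).symm (Z, Y)))
      (measurable_split_symm_left S hΦm Y) (symm_split_symm_left S hΦs Y)
    have hn4 : (S.card : ℝ) ≤ 4 * (ρμ * ℓ ^ 3) := by rw [hcard]; exact hr4
    refine (sector_bound_last h (hgap _ hn4) (nPlusBoxN_le_kinBoxN χ ℓ s b u _)).trans ?_
    gcongr
    exact hE _ hn4
  -- summing over the groups (2.14)
  have hsum := add_le_add (Finset.sum_le_sum fun t (_ : t ∈ (Finset.univ : Finset (Fin q))) => hfull t) hlast
  rw [← lintegral_attr_groups hvmeas hω.measurable hχ ℓ ρμ u hΦm e] at hsum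
  refine hsum.trans ?_
  simp only [zero_mul, add_zero, Finset.sum_add_distrib]
  have hkin : (∑ t : Fin q, ∑ i ∈ Finset.univ.image (fun j : Fin m => e.symm (Sum.inl (j, t))),
        (ENNReal.ofReal ℓ ^ 3)⁻¹ * ∫⁻ X in boxConfig M ℓ u, kinLoc χ ℓ s b u fun x => Φ (Function.update X i x)) +
      (∑ i ∈ Finset.univ.image (fun j : Fin r => e.symm (Sum.inr j)),
        (ENNReal.ofReal ℓ ^ 3)⁻¹ * ∫⁻ X in boxConfig M ℓ u, kinLoc χ ℓ s b u fun x => Φ (Function.update X i x)) =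
      kinBoxN χ ℓ s b u Φ := by
    unfold kinBoxN
    exact (sum_eq_sum_groups e _).symm
  have hrep := sum_lintegral_rep_groups_le hvmeas hχ ℓ u hΦm e
  calc _ = ((∑ t : Fin q, ∑ i ∈ Finset.univ.image (fun j : Fin m => e.symm (Sum.inl (j, t))),
          (ENNReal.ofReal ℓ ^ 3)⁻¹ * ∫⁻ X in boxConfig M ℓ u, kinLoc χ ℓ s b u fun x => Φ (Function.update X i x)) +
        ∑ i ∈ Finset.univ.image (fun j : Fin r => e.symm (Sum.inr j)),
          (ENNReal.ofReal ℓ ^ 3)⁻¹ * ∫⁻ X in boxConfig M ℓ u, kinLoc χ ℓ s b u fun x => Φ (Function.update X i x)) +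
        ((∑ t : Fin q, ∫⁻ X in boxConfig M ℓ u,
          (∑ i ∈ Finset.univ.image (fun j : Fin m => e.symm (Sum.inl (j, t))),
            ∑ i' ∈ Finset.univ.image (fun j : Fin m => e.symm (Sum.inl (j, t))) with i < i',
              pairLoc v χ ℓ u (X i) (X i')) * (‖Φ X‖₊ : ℝ≥0∞) ^ 2) +
          ∫⁻ X in boxConfig M ℓ u,
            (∑ i ∈ Finset.univ.image (fun j : Fin r => e.symm (Sum.inr j)),
              ∑ i' ∈ Finset.univ.image (fun j : Fin r => e.symm (Sum.inr j)) with i < i',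
                pairLoc v χ ℓ u (X i) (X i')) * (‖Φ X‖₊ : ℝ≥0∞) ^ 2) +
        ENNReal.ofReal Bl * ∫⁻ X in boxConfig M ℓ u, (‖Φ X‖₊ : ℝ≥0∞) ^ 2 := by ring
    _ ≤ kinBoxN χ ℓ s b u Φ +
        (∫⁻ X in boxConfig M ℓ u, repBoxN v χ ℓ u X * (‖Φ X‖₊ : ℝ≥0∞) ^ 2) +
        ENNReal.ofReal Bl * ∫⁻ X in boxConfig M ℓ u, (‖Φ X‖₊ : ℝ≥0∞) ^ 2 := by
        rw [hkin]
        gcongr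

end Assembly

end Literature.MathematicalPhysics.QuantumManyBody.BoseGas

end
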